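import Literature.NumberTheory.EllipticCurves.IwasawaNakayamaProofs
import Literature.NumberTheory.EllipticCurves.IwasawaEulerCharDualityProofs
import Literature.NumberTheory.EllipticCurves.IwasawaAlgebraProofs
import HarnessLib

/-!
# Crux `PrintCf2.SplitBadTwoRankOneOfFacts` (stmt-BirchSwinnertonDyer-20368), skeleton v12.1, stub S3d `stub_strictDefectAtVbar_two` —
# the ALGEBRAIC SPINE, part I (pure `Λ = ℤ_p⟦T⟧`-algebra): the KERNEL of a transpose of dual pairs is a dual pair for the QUOTIENT, a finite
# `Γ`-module has Euler characteristic `1`, and `ord_p H'(0) = ord_p H_K(0) + ord_p H(0)` along a surjection of torsion Iwasawa modules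

Cell `bsd-print-cf2`, EXTRA WIDTH seat `bsd-line-cf2-p1-w3` g11 (prover-bsd-line-cf2-p1-w3-g11-0); `--supports stmt-BirchSwinnertonDyer-20368`
(helper, Theses-free, Mathlib + the tree's `IwasawaDual`/`IwasawaAlgebra` API only). HONEST FRAMING: nothing here closes the crux or the registered
stub S3d; BSD is not proved by any of this; no summit statement is proved by this seat. No definition, no named fact, no `sorry`.

WHAT (any prime `p`; abstract dual pairs `IwasawaDual.IsDualPair` of `IwasawaNakayamaProofs`). The sequel `PrintCf2SplitBadTwoStrictDatumOfUnrDatum`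
applies this to `𝔖_𝔮(K_∞, M) ≤ H¹_{𝓕_nr}(K_∞, M)` on a `ℤ_p`-line (Agboola's strict datum from the Greenberg–Vatsal unramified datum).
* §1 **`exists_isDualPair_ker`** — for dual pairs `(X, S, ψ)`, `(X', S', ψ')`, an additive `φ : S' → S` and a `Λ`-linear `F : X → X'` with
  `toDual' (F x) = toDual x ∘ φ` (the transpose of `IsDualPair.exists_linearMap_comp`), the kernel `ker F` is a dual pair for `S ⧸ φ(S')` with any
  endomorphism `ψ_Q` lifting `ψ` — the complement of bsd-eis `IwasawaTwoVariable.exists_isDualPair_quotient` (which dualises the SUBGROUP);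
  **`natCard_endInvariants_eq_of_finite`** — `#Q^{ψ} = #Q_{ψ}` for an endomorphism of a FINITE abelian group.
* §2 **`exists_charGenerators_of_surjective`** — along a surjection `F : X ↠ Y` of `Λ`-modules with `X` finitely generated torsion, `char X = (H')`,
  `H'(0) ≠ 0`: generators `char (ker F) = (H_K)`, `char Y = (H)` with `H_K(0) ≠ 0`, `H(0) ≠ 0` and **`ord_p H'(0) = ord_p H_K(0) + ord_p H(0)`**
  (`Module.charIdeal_eq_mul_of_exact`; `Λ` a UFD, `charIdeal_isPrincipal_holds`; a unit of `Λ` has a unit constant term).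
presearch: Greenberg LNM 1716 §1 p. 60 / Lemma 4.2 (the Pontryagin dual as a `Λ`-module; Euler characteristic) and NSW (5.3.9) Remark 2 — tree
theorems; no new fact. beyond-print theorem: no.

References: [GreenbergLNM1716] §1 p. 60, §4 Lemma 4.2; [GreenbergVatsal2000] §2 pp. 17–21; [NeukirchSchmidtWingberg2008] (5.3.9) Remark 2;
[Lang1990] Ch. 5 §1.
-/

noncomputable section

open scoped Classical
-- the summit namespace `Summit.BirchSwinnertonDyer.BirchSwinnertonDyer` repeats the problem name by design (D-0017)
set_option linter.dupNamespace false
set_option autoImplicit false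

open Literature.NumberTheory.EllipticCurves
open Literature.NumberTheory.EllipticCurves.IwasawaAlgebra Literature.NumberTheory.EllipticCurves.IwasawaDual

namespace Summit.BirchSwinnertonDyer.BirchSwinnertonDyer.Theorems.PrintCf2.StrictDefect

/-! ## §1. Abstract dual pairs: the kernel of the transpose of `φ : S' → S` is a dual pair for `S ⧸ φ(S')` -/

section KernelPair

variable (p : ℕ) [Fact p.Prime] {S : Type*} [AddCommGroup S] {ψ : AddMonoid.End S}
  {X : Type*} [AddCommGroup X] [Module (IwasawaAlgebra p) X] {toDual : X →+ (S →+ AddCircle (1 : ℚ))}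
  {S' : Type*} [AddCommGroup S'] {ψ' : AddMonoid.End S'}
  {X' : Type*} [AddCommGroup X'] [Module (IwasawaAlgebra p) X'] {toDual' : X' →+ (S' →+ AddCircle (1 : ℚ))}

omit [Fact p.Prime] in
/-- Powers of an endomorphism `ψ_Q` of a quotient `S ⧸ N` lifting `ψ`: `(ψ_Q)^n [s] = [ψ^n s]`. [folklore] -/
theorem quotient_pow_mk (N : AddSubgroup S) (ψQ : AddMonoid.End (S ⧸ N))
    (hψQ : ∀ s : S, ψQ (QuotientAddGroup.mk s) = QuotientAddGroup.mk (ψ s)) (n : ℕ) (s : S) :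
    (ψQ ^ n) (QuotientAddGroup.mk s) = QuotientAddGroup.mk ((ψ ^ n) s) := by
  induction n generalizing s with
  | zero => rfl
  | succ n ih =>
    rw [pow_succ, pow_succ, AddMonoid.End.coe_mul, Function.comp_apply, AddMonoid.End.coe_mul,
      Function.comp_apply, hψQ]
    exact ih _

/-- **The kernel of a transpose is a dual pair for the quotient.** For dual pairs `(X, S, ψ, toDual)`, `(X', S', ψ', toDual')` over
`Λ = ℤ_p⟦T⟧`, an additive `φ : S' → S`, and a `Λ`-linear `F : X → X'` with `toDual' (F x) = toDual x ∘ φ` (the transpose,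
`IsDualPair.exists_linearMap_comp`): with `N = φ(S')` and any endomorphism `ψ_Q` of `S ⧸ N` lifting `ψ` (`ψ_Q [s] = [ψ s]`), `toDual` identifies
`ker F` — the `x` whose character kills `N` — with `Hom(S ⧸ N, ℚ/ℤ)`, and this is again a dual pair for `ψ_Q` (`T ↦ ψ_Q`; constants through
`ℤ_p → ℤ/p^k`, using that `x` kills `p^k s ∈ N`; `(p, ψ_Q)` locally nilpotent as a quotient of `(p, ψ)`). Complement of bsd-eis
`IwasawaTwoVariable.exists_isDualPair_quotient` (the dual of the SUBGROUP as a quotient pair). [cite: GreenbergLNM1716, §1 p. 60]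
[cite: GreenbergVatsal2000, §2 p. 17] -/
theorem exists_isDualPair_ker (h : IsDualPair p ψ toDual) (h' : IsDualPair p ψ' toDual')
    (φ : S' →+ S) (F : X →ₗ[IwasawaAlgebra p] X') (hF : ∀ (x : X) (s' : S'), toDual' (F x) s' = toDual x (φ s'))
    (N : AddSubgroup S) (hNφ : N = φ.range) (ψQ : AddMonoid.End (S ⧸ N))
    (hψQ : ∀ s : S, ψQ (QuotientAddGroup.mk s) = QuotientAddGroup.mk (ψ s)) :
    ∃ toDualK : LinearMap.ker F →+ (S ⧸ N →+ AddCircle (1 : ℚ)),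
      IsDualPair p ψQ toDualK ∧
      ∀ (x : LinearMap.ker F) (s : S), toDualK x (QuotientAddGroup.mk s) = toDual (x : X) s := by
  -- characters of `ker F` kill `N = φ(S')`
  have hkill : ∀ x : LinearMap.ker F, N ≤ (toDual (x : X)).ker := by
    rintro x s hs
    rw [hNφ] at hs
    obtain ⟨s', rfl⟩ := hs
    rw [AddMonoidHom.mem_ker, ← hF, LinearMap.mem_ker.mp x.2, map_zero, AddMonoidHom.zero_apply]
  let toDualK : LinearMap.ker F →+ (S ⧸ N →+ AddCircle (1 : ℚ)) :=
    { toFun := fun x ↦ QuotientAddGroup.lift N (toDual (x : X)) (hkill x)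
      map_zero' := by
        refine AddMonoidHom.ext fun q ↦ ?_
        obtain ⟨s, rfl⟩ := QuotientAddGroup.mk_surjective q
        rw [QuotientAddGroup.lift_mk, ZeroMemClass.coe_zero, map_zero, AddMonoidHom.zero_apply, AddMonoidHom.zero_apply]
      map_add' := fun x y ↦ by
        refine AddMonoidHom.ext fun q ↦ ?_
        obtain ⟨s, rfl⟩ := QuotientAddGroup.mk_surjective q
        rw [AddMonoidHom.add_apply, QuotientAddGroup.lift_mk, QuotientAddGroup.lift_mk, QuotientAddGroup.lift_mk,
          AddMemClass.coe_add, map_add, AddMonoidHom.add_apply] }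
  have hK : ∀ (x : LinearMap.ker F) (s : S), toDualK x (QuotientAddGroup.mk s) = toDual (x : X) s := fun _ _ ↦ rfl
  refine ⟨toDualK, ⟨⟨?_, ?_⟩, ?_, ?_, ⟨?_, ?_⟩⟩, hK⟩
  · -- injective
    rw [injective_iff_map_eq_zero]
    intro x hx
    apply Subtype.ext
    apply h.bijective.1
    rw [ZeroMemClass.coe_zero, map_zero]
    ext s
    rw [← hK x s, hx, AddMonoidHom.zero_apply, AddMonoidHom.zero_apply]
  · -- surjective
    intro χ
    obtain ⟨x, hx⟩ := h.bijective.2 (χ.comp (QuotientAddGroup.mk' N))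
    have hxker : x ∈ LinearMap.ker F := by
      rw [LinearMap.mem_ker]
      apply h'.bijective.1
      rw [map_zero]
      ext s'
      have hs'N : QuotientAddGroup.mk (s := N) (φ s') = 0 := by
        rw [QuotientAddGroup.eq_zero_iff, hNφ]
        exact ⟨s', rfl⟩
      rw [hF, hx, AddMonoidHom.comp_apply, QuotientAddGroup.mk'_apply, hs'N, map_zero, AddMonoidHom.zero_apply]
    refine ⟨⟨x, hxker⟩, ?_⟩
    refine AddMonoidHom.ext fun q ↦ ?_
    obtain ⟨s, rfl⟩ := QuotientAddGroup.mk_surjective q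
    rw [hK, hx, AddMonoidHom.comp_apply, QuotientAddGroup.mk'_apply]
  · -- `T` acts as `ψ_Q`
    intro x q
    obtain ⟨s, rfl⟩ := QuotientAddGroup.mk_surjective q
    rw [hψQ, hK, hK, Submodule.coe_smul, h.T_smul]
  · -- constants act through `ℤ_p → ℤ/p^k`
    intro c x q k hk
    obtain ⟨s, rfl⟩ := QuotientAddGroup.mk_surjective q
    obtain ⟨m, hm⟩ := h.locNil.torsion s
    have hmk : p ^ (m + k) • s = 0 := by
      rw [pow_add, mul_comm, mul_smul, hm, smul_zero]
    have hka : p ^ k • toDual (x : X) s = 0 := by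
      have hks : p ^ k • s ∈ N := by
        rw [← QuotientAddGroup.eq_zero_iff, QuotientAddGroup.mk_nsmul, hk]
      rw [← map_nsmul]
      exact hkill x hks
    rw [hK, hK, Submodule.coe_smul, h.C_smul c (x : X) s (m + k) hmk]
    exact zpT_of_le (Nat.le_add_left k m) hka c
  · -- `p`-primary
    intro q
    obtain ⟨s, rfl⟩ := QuotientAddGroup.mk_surjective q
    obtain ⟨k, hk⟩ := h.locNil.torsion s
    exact ⟨k, by rw [← QuotientAddGroup.mk_nsmul, hk, QuotientAddGroup.mk_zero]⟩
  · -- `ψ_Q` locally nilpotent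
    intro q
    obtain ⟨s, rfl⟩ := QuotientAddGroup.mk_surjective q
    obtain ⟨n, hn⟩ := h.locNil.nil s
    exact ⟨n, by rw [quotient_pow_mk N ψQ hψQ, hn, QuotientAddGroup.mk_zero]⟩

omit [Fact p.Prime] in
/-- **A FINITE `Γ`-module has Euler characteristic `1`: `#Q^{ψ} = #Q_{ψ}`** for any endomorphism `ψ` of a finite abelian group `Q`
(`#Q = #ker ψ · #ψ(Q) = #(Q ⧸ ψ(Q)) · #ψ(Q)`). With `hasCharValuationAt_restricted_of_unr` below: a FINITE strict/unramified defect
`S_nr ⧸ 𝔖` does not move `ord_p H(0)` (classes (i)/(ii) of -w6 g4's S3d census). [cite: GreenbergLNM1716, §4 Lemma 4.2 (p. 103)] -/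
theorem natCard_endInvariants_eq_of_finite {Q : Type*} [AddCommGroup Q] [Finite Q] (ψQ : AddMonoid.End Q) :
    Nat.card (endInvariants ψQ) = Nat.card (EndCoinvariants ψQ) := by
  have h1 := AddSubgroup.card_eq_card_quotient_mul_card_addSubgroup
    (AddMonoidHom.ker (AddMonoidHomClass.toAddMonoidHom ψQ))
  have h2 := AddSubgroup.card_eq_card_quotient_mul_card_addSubgroup
    (AddMonoidHom.range (AddMonoidHomClass.toAddMonoidHom ψQ))
  have h3 : Nat.card (Q ⧸ AddMonoidHom.ker (AddMonoidHomClass.toAddMonoidHom ψQ)) =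
      Nat.card (AddMonoidHom.range (AddMonoidHomClass.toAddMonoidHom ψQ)) :=
    Nat.card_congr (QuotientAddGroup.quotientKerEquivRange _).toEquiv
  have hpos : 0 < Nat.card (AddMonoidHom.range (AddMonoidHomClass.toAddMonoidHom ψQ)) := Nat.card_pos
  rw [h3] at h1
  rw [h1, mul_comm (Nat.card (Q ⧸ AddMonoidHom.range (AddMonoidHomClass.toAddMonoidHom ψQ))) _] at h2
  exact Nat.eq_of_mul_eq_mul_left hpos h2

end KernelPair

/-! ## §2. `Λ`-algebra: constant terms of characteristic generators are multiplicative along a surjection -/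

section CharSplit

variable {p : ℕ} [Fact p.Prime] {X Y : Type*} [AddCommGroup X] [Module (IwasawaAlgebra p) X] [AddCommGroup Y]
  [Module (IwasawaAlgebra p) Y]

/-- **`ord_p H'(0) = ord_p H_K(0) + ord_p H(0)` along `0 → ker F → X → Y → 0`.** For a surjective `Λ`-linear `F : X → Y` with `X` finitely
generated torsion, `char_Λ X = (H')` and `H'(0) ≠ 0`: there are generators `char_Λ (ker F) = (H_K)`, `char_Λ Y = (H)` (`Λ` a UFD:
`charIdeal_isPrincipal_holds`), and `H' ~ H_K · H` (`Module.charIdeal_eq_mul_of_exact`), whence `H_K(0) ≠ 0`, `H(0) ≠ 0` and the displayed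
valuation identity (a unit of `Λ` has a unit constant term). [cite: NeukirchSchmidtWingberg2008, Ch. V §3, Remark 2 after (5.3.9)]
[cite: GreenbergLNM1716, §4 Lemma 4.2] -/
theorem exists_charGenerators_of_surjective [Module.Finite (IwasawaAlgebra p) X] (hX : Module.IsTorsion (IwasawaAlgebra p) X)
    (F : X →ₗ[IwasawaAlgebra p] Y) (hF : Function.Surjective F) {H' : IwasawaAlgebra p}
    (hH' : Module.charIdeal (IwasawaAlgebra p) X = Ideal.span {H'}) (hH'0 : PowerSeries.constantCoeff H' ≠ 0) :
    ∃ (HK H : IwasawaAlgebra p),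
      Module.charIdeal (IwasawaAlgebra p) (LinearMap.ker F) = Ideal.span {HK} ∧
      Module.charIdeal (IwasawaAlgebra p) Y = Ideal.span {H} ∧
      PowerSeries.constantCoeff HK ≠ 0 ∧ PowerSeries.constantCoeff H ≠ 0 ∧
      (PowerSeries.constantCoeff H').valuation =
        (PowerSeries.constantCoeff HK).valuation + (PowerSeries.constantCoeff H).valuation := by
  obtain ⟨HK, hHK⟩ := (charIdeal_isPrincipal_holds p (LinearMap.ker F)).principal
  obtain ⟨H, hH⟩ := (charIdeal_isPrincipal_holds p Y).principal
  have hmul := Module.charIdeal_eq_mul_of_exact hX (LinearMap.ker F).subtype F (Submodule.injective_subtype _) hF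
    (LinearMap.exact_subtype_ker_map F)
  rw [hH', hHK, hH, Ideal.span_singleton_mul_span_singleton] at hmul
  obtain ⟨u, hu⟩ := Ideal.span_singleton_eq_span_singleton.mp hmul
  have hc : PowerSeries.constantCoeff H' * PowerSeries.constantCoeff (u : IwasawaAlgebra p) =
      PowerSeries.constantCoeff HK * PowerSeries.constantCoeff H := by
    rw [← map_mul, hu, map_mul]
  have hu0 : IsUnit (PowerSeries.constantCoeff (u : IwasawaAlgebra p)) := PowerSeries.isUnit_constantCoeff _ u.isUnit
  have hprod : PowerSeries.constantCoeff HK * PowerSeries.constantCoeff H ≠ 0 := by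
    rw [← hc]
    exact mul_ne_zero hH'0 hu0.ne_zero
  refine ⟨HK, H, hHK, hH, left_ne_zero_of_mul hprod, right_ne_zero_of_mul hprod, ?_⟩
  have e := congrArg PadicInt.valuation hc
  -- a unit of `ℤ_p` has valuation `0`
  have hval0 : (PowerSeries.constantCoeff (u : IwasawaAlgebra p)).valuation = 0 := by
    have h1 : ‖PowerSeries.constantCoeff (u : IwasawaAlgebra p)‖ = 1 := PadicInt.isUnit_iff.mp hu0
    rw [PadicInt.norm_eq_zpow_neg_valuation hu0.ne_zero] at h1
    have hp1 : (1 : ℝ) < p := by exact_mod_cast (Fact.out : p.Prime).one_lt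
    have := zpow_right_injective₀ (by positivity) hp1.ne' (h1.trans (zpow_zero (p : ℝ)).symm)
    omega
  rw [PadicInt.valuation_mul hH'0 hu0.ne_zero, PadicInt.valuation_mul (left_ne_zero_of_mul hprod) (right_ne_zero_of_mul hprod),
    hval0, add_zero] at e
  exact e

end CharSplit

end Summit.BirchSwinnertonDyer.BirchSwinnertonDyer.Theorems.PrintCf2.StrictDefect

end
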